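import Literature.MathematicalPhysics.QuantumFieldTheory.Federbush1986.LatticeContourHomotopy
import Literature.MathematicalPhysics.QuantumFieldTheory.Balaban1983to89.B6BondElimination

/-!
# Federbush, *A phase cell approach to Yang–Mills theory* III [Federbush1987PhaseCellIII] — Lemma 5.6 (5.13) p. 301 with
# the printed CONTOUR COUNT proved: Bałaban's contours `Γ_{c₋,x} ∪ [x, x(c)] ∪ Γ_{x(c),c₊}` of (1.8) of [1]
# (= [Balaban1984PropagatorsI]) are pairwise related by `≤ 8(N−1)N` elementary homotopies (d = 4; `2d(N−1)N` in
# dimension `d`) across plaquettes of the two `N^d` blocks, hence `d(g_{Γ₁}, g_{Γ₂}) ≤ 8(N−1)N·a` when these are s.f.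

statement-level skeleton of published theorems with citation tags; proofs where landed; nothing here is a claim about the Yang–Mills mass gap

PDF held: HELD-LOCAL L03 (`run/shared/lean/pub/pub-balaban/t4/b2b-balaban-t4-lit2/pdf/fed1987-cmp110-III.pdf`), p. 301
(OCR `…/texts/fed1987-cmp110-III/p009.txt`, render r17 `fedIII/…-p009`): «5.2. Regime 1. The group element assigned to a
bond in P is an average of N⁴ group elements associated with N⁴ contours as enter (in the Abelian case) in (1.8) of [1].
Γ_{c₋,x} of (1.8) contains ≤ 4(N − 1) bonds. If we consider x′ so that Γ_{c₋,x′} ⊂ Γ_{c₋,x} with one less bond, then the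
contours associated to x and x′ are related by ≤ N elementary homotopies. Thus any contour is related to the straight line
contour ⟨c₋, c₊⟩ by ≤ 4(N − 1)N elementary homotopies; and any two contours are related by ≤ 8(N − 1)N elementary
homotopies. Lemma 5.6. Let Γ₁ and Γ₂ be two contours whose associated group elements are averaged (along with N⁴ − 2
others) to yield a group assignment to a bond of P. Assume all p_i are s.f. Then d(g_{Γ₁}, g_{Γ₂}) ≤ 8(N − 1)Na. (5.13)»;
p. 298 (§4): «A plaquette p is s.f. if |A_{∂p}| < a (more properly, |g_{∂p}| < a …) … We also consider exactly those
plaquettes {p_i}_{i∈P} in the level r + 1 all of whose vertices lie in the four N⁴ size blocks, vertices of the plaquette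
P.»  [1] = [Balaban1984PropagatorsI] (held `paper:balaban1984-cmp95-propagators-rt-i`), (1.6)–(1.8) p. 18–19: blocks
«B(y) = {x : y_μ ≤ x_μ < y_μ + L}», contours «Γ_{y,x} = [y, (y₁, …, y_{d−1}, x_d)] ∪ … ∪ [(y₁, x₂, …, x_d), x]» (1.7) and the
three-contour average of (1.8) over «Γ_{c₋,x}», «[x, x(c)]», «Γ_{x(c),c₊}», «x(c) = x + Le_μ» (the tree's notions of record:
`Balaban1983to89.B6Elimination.block`, `Balaban1983to89.B6BondElimination.contour`).

WHAT IS REPRODUCED (cell `lit-balaban`, Phase-2 proof seat p32 gen 5; HOME `run/shared/lean/pub/lit-balaban/`; SKELETON row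
**F3.Lem5.6** — r17: «proved p238910 given the printed contour count (hypothesis `hn`; the count itself: absent, lattice
geometry)»; statement file `Federbush1986/PureAverages.lean` (r17) UNCHANGED; generic word/homotopy layer in
`LatticeContourHomotopy.lean` (this seat)).  Federbush's block side `N` is Bałaban's `L`; dimension `d` arbitrary (print:
d = 4, «N⁴ contours», «4(N−1)»).

* §1 `seg`, `treeWord y x` — the contour `Γ_{y,x}` of (1.7) as a WORD (segments in the order of (1.7): direction `d`
  first, …, direction `1` last; all bonds forward), with `isPath_treeWord`, `length_treeWord_le` («contains ≤ 4(N−1)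
  bonds»: `≤ d(N−1)`), the translation law, and the fidelity certificate **`mem_treeWord_iff`**: its bonds are exactly
  `B6BondElimination.contour N y x`.
* §2 `contourWord N c μ x = Γ_{c₋,x} ∪ [x, x(c)] ∪ Γ_{x(c),c₊}` (1.8) (`c₋ = c`, `c₊ = c + Ne_μ`, `x(c) = x + Ne_μ`,
  `Γ_{x(c),c₊}` = `Γ_{c₊,x(c)}` reversed), a contour from `c₋` to `c₊`; `contourWord N c μ c = seg c μ N` = «the straight
  line contour ⟨c₋, c₊⟩».
* §3 the LADDER: removing the last tree bond costs `≤ N` elementary homotopies (`rung`: exactly `N` across the plaquettes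
  `(w + te_μ; μ, ν)`, `t < N`, plus one free cancellation; `0` if the bond is parallel to `e_μ`), for any forward tree
  path (`moves_ladder`: `≤ N·|T|`).
* §4 **`moves_contourWord_straight`** (`≤ d(N−1)·N` to the straight contour), **`moves_contourWord_contourWord`**
  (`≤ 2d(N−1)N` between any two), all homotopies across plaquettes with all four vertices in `B(c₋) ∪ B(c₊)` (two of the
  «four N⁴ size blocks»: `Admissible`); at `d = 4` the printed `4(N−1)N` / `8(N−1)N` (`moves_contourWord_contourWord_dim4`).
* §5 **`lemma56`** — (5.13): if every plaquette with all vertices in `B(c₋) ∪ B(c₊)` is s.f. (`|g_{∂p}| < a`), then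
  `d(g_{Γ(x)}, g_{Γ(x′)}) ≤ 2d(N−1)N·a`, obtained THROUGH r17's `dist_le_of_chain_count` with its hypotheses `hstep`/`hsf`/`hn`
  supplied (`Moves.dist_wordHol_le_of_le`); `lemma56_dim4`: `≤ 8(N−1)N·a`.

No new named facts; axioms standard.
-/

namespace Literature.MathematicalPhysics.QuantumFieldTheory.Federbush1986

namespace LatticeContour

open scoped BigOperators
open Literature.MathematicalPhysics.QuantumFieldTheory.Balaban1983to89.B6Elimination (block mem_block)
open Literature.MathematicalPhysics.QuantumFieldTheory.Balaban1983to89.B6BondElimination (contour mem_contour)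

variable {d : ℕ}

/-! ## §1  Straight segments and Bałaban's tree contours `Γ_{y,x}` of (1.7) as words -/

/-- The straight contour `[z, z + n e_μ]` (n unit bonds in direction `e_μ`, all forward), e.g. «[x, x(c)]» of (1.8).
[cite: Balaban1984PropagatorsI, (1.7)–(1.8) pp. 18–19] -/
def seg (z : Site d) (μ : Fin d) (n : ℕ) : List (Letter d) :=
  (List.range n).map fun t : ℕ => ((z + (t : ℤ) • ev μ, μ), true)

/-- The straight contour with no bonds. [cite: Balaban1984PropagatorsI, (1.7) p. 18] -/
@[simp] theorem seg_zero (z : Site d) (μ : Fin d) : seg z μ 0 = [] := by simp [seg]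

/-- `[z, z + (n+1)e_μ] = [z, z + ne_μ] ∪ ⟨z + ne_μ, z + (n+1)e_μ⟩`. [cite: Balaban1984PropagatorsI, (1.7) p. 18] -/
theorem seg_succ (z : Site d) (μ : Fin d) (n : ℕ) :
    seg z μ (n + 1) = seg z μ n ++ [((z + (n : ℤ) • ev μ, μ), true)] := by
  simp [seg, List.range_succ]

/-- `[z, z + (n+1)e_μ] = ⟨z, z + e_μ⟩ ∪ [z + e_μ, z + (n+1)e_μ]`. [cite: Balaban1984PropagatorsI, (1.7) p. 18] -/
theorem seg_succ' (z : Site d) (μ : Fin d) (n : ℕ) :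
    seg z μ (n + 1) = ((z, μ), true) :: seg (z + ev μ) μ n := by
  simp only [seg, List.range_succ_eq_map, List.map_cons, List.map_map, Nat.cast_zero, zero_smul, add_zero]
  congr 1
  refine List.map_congr_left fun t _ => ?_
  simp only [Function.comp_apply, Nat.cast_succ, add_smul, one_smul]
  rw [add_comm ((t : ℤ) • ev μ) (ev μ), add_assoc]

/-- `[z, z + ne_μ]` has `n` bonds. [cite: Balaban1984PropagatorsI, (1.7) p. 18] -/
@[simp] theorem length_seg (z : Site d) (μ : Fin d) (n : ℕ) : (seg z μ n).length = n := by simp [seg]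

/-- The bonds of `[z, z + ne_μ]`. [cite: Balaban1984PropagatorsI, (1.7) p. 18] -/
theorem mem_seg {z : Site d} {μ : Fin d} {n : ℕ} {l : Letter d} :
    l ∈ seg z μ n ↔ ∃ t < n, l = ((z + (t : ℤ) • ev μ, μ), true) := by
  simp [seg, eq_comm]

/-- `[z, z + n e_μ]` runs from `z` to `z + n e_μ`. [cite: Balaban1984PropagatorsI, (1.7) p. 18] -/
theorem isPath_seg (z : Site d) (μ : Fin d) (n : ℕ) : IsPath z (z + (n : ℤ) • ev μ) (seg z μ n) := by
  induction n generalizing z with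
  | zero => simp
  | succ n ih =>
    rw [seg_succ', isPath_cons]
    refine ⟨rfl, ?_⟩
    have h := ih (z + ev μ)
    have e : z + ev μ + (n : ℤ) • ev μ = z + ((n + 1 : ℕ) : ℤ) • ev μ := by
      push_cast; rw [add_smul, one_smul, add_assoc, add_comm (ev μ)]
    rwa [e] at h

/-- Translation of a straight contour. [cite: Balaban1984PropagatorsI, (1.7) p. 18] -/
theorem seg_map_shift (z v : Site d) (μ : Fin d) (n : ℕ) : (seg z μ n).map (shift v) = seg (z + v) μ n := by
  simp [seg, shift, add_right_comm]

/-- The point of (1.7) whose coordinates `< k` are those of `y` and `≥ k` those of `x`: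
`(y₁, …, y_k, x_{k+1}, …, x_d)` (0-indexed). [cite: Balaban1984PropagatorsI, (1.7) p. 18] -/
def mixN (y x : Site d) (k : ℕ) : Site d := fun j => if k ≤ j.val then x j else y j

/-- `(x₁, …, x_d) = x`. [cite: Balaban1984PropagatorsI, (1.7) p. 18] -/
@[simp] theorem mixN_zero (y x : Site d) : mixN y x 0 = x := by
  funext j; simp [mixN]

/-- `(y₁, …, y_d) = y`. [cite: Balaban1984PropagatorsI, (1.7) p. 18] -/
theorem mixN_of_le (y x : Site d) {k : ℕ} (hk : d ≤ k) : mixN y x k = y := by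
  funext j; have := j.isLt; simp [mixN]; intro h; omega

/-- Translation covariance of the intermediate points of (1.7). [cite: Balaban1984PropagatorsI, (1.7) p. 18] -/
theorem mixN_add (y x v : Site d) (k : ℕ) : mixN (y + v) (x + v) k = mixN y x k + v := by
  funext j; simp only [mixN, Pi.add_apply]; split_ifs <;> rfl

/-- The segment of (1.7) in direction `k` ends where the next one starts:
`mixN y x (k+1) + (x_k − y_k) e_k = mixN y x k`. [cite: Balaban1984PropagatorsI, (1.7) p. 18] -/
theorem mixN_succ_add {y x : Site d} {k : ℕ} (hk : k < d) (hyx : y ⟨k, hk⟩ ≤ x ⟨k, hk⟩) :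
    mixN y x (k + 1) + ((x ⟨k, hk⟩ - y ⟨k, hk⟩).toNat : ℤ) • ev ⟨k, hk⟩ = mixN y x k := by
  funext j
  simp only [Pi.add_apply, Pi.smul_apply, smul_eq_mul, mixN, ev_apply]
  by_cases hj : j = ⟨k, hk⟩
  · subst hj
    simp only [if_true]
    rw [Int.toNat_of_nonneg (by omega)]
    simp
  · have hjv : j.val ≠ k := fun h => hj (Fin.ext h)
    simp only [hj, if_false, mul_zero, add_zero]
    by_cases h1 : k + 1 ≤ j.val
    · simp [h1, show k ≤ j.val by omega]
    · simp [h1, show ¬ k ≤ j.val by omega]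

/-- The segments of (1.7) in directions `k, k−1, …, 1` (0-indexed `k−1, …, 0`), from `mixN y x k` to `x`.
[cite: Balaban1984PropagatorsI, (1.7) p. 18] -/
def combFrom (y x : Site d) : ℕ → List (Letter d)
  | 0 => []
  | k + 1 => (if h : k < d then seg (mixN y x (k + 1)) ⟨k, h⟩ (x ⟨k, h⟩ - y ⟨k, h⟩).toNat else []) ++ combFrom y x k

/-- **The contour `Γ_{y,x}` of (1.7)** «Γ_{y,x} = [y, (y₁, …, y_{d−1}, x_d)] ∪ … ∪ [(y₁, …, y_μ, x_{μ+1}, …, x_d), (y₁, …, x_μ,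
x_{μ+1}, …, x_d)] ∪ … ∪ [(y₁, x₂, …, x_d), x]» as a word (oriented from `y` to `x`, all bonds forward).
[cite: Balaban1984PropagatorsI, (1.7) p. 18] -/
def treeWord (y x : Site d) : List (Letter d) := combFrom y x d

/-- The last `k` segments of (1.7) form a contour from `(y₁, …, y_k, x_{k+1}, …, x_d)` to `x` (when `y ≤ x` coordinatewise, i.e. `x ∈ B(y)`). [cite: Balaban1984PropagatorsI, (1.7) p. 18] -/
theorem isPath_combFrom {y x : Site d} (hyx : ∀ i, y i ≤ x i) :
    ∀ k, IsPath (mixN y x k) x (combFrom y x k)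
  | 0 => by simp [combFrom]
  | k + 1 => by
    rw [combFrom]
    by_cases hk : k < d
    · rw [dif_pos hk]
      refine IsPath.append ?_ (isPath_combFrom hyx k)
      have h := isPath_seg (mixN y x (k + 1)) ⟨k, hk⟩ (x ⟨k, hk⟩ - y ⟨k, hk⟩).toNat
      rwa [mixN_succ_add hk (hyx _)] at h
    · rw [dif_neg hk, List.nil_append, mixN_of_le y x (show d ≤ k + 1 by omega)]
      have h := isPath_combFrom hyx k
      rwa [mixN_of_le y x (show d ≤ k by omega)] at h

/-- «oriented contours, with initial point y and final point x» (B5 p. 18). [cite: Balaban1984PropagatorsI, (1.7) p. 18] -/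
theorem isPath_treeWord {y x : Site d} (hyx : ∀ i, y i ≤ x i) : IsPath y x (treeWord y x) := by
  have h := isPath_combFrom hyx d
  rwa [mixN_of_le y x le_rfl] at h

/-- Bond count of the last `k` segments of (1.7). [cite: Balaban1984PropagatorsI, (1.7) p. 18] -/
theorem length_combFrom_le {y x : Site d} {m : ℕ} (hm : ∀ i, (x i - y i).toNat ≤ m) :
    ∀ k, (combFrom y x k).length ≤ k * m
  | 0 => by simp [combFrom]
  | k + 1 => by
    rw [combFrom, List.length_append, Nat.succ_mul]
    have ih := length_combFrom_le hm k
    by_cases hk : k < d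
    · rw [dif_pos hk, length_seg]; have := hm ⟨k, hk⟩; omega
    · rw [dif_neg hk]; simp; omega

/-- «Γ_{c₋,x} of (1.8) contains ≤ 4(N − 1) bonds»: `≤ d(N−1)` for `x ∈ B(y)` in dimension `d`.
[cite: Federbush1987PhaseCellIII, §5.2 p. 301] -/
theorem length_treeWord_le {N : ℕ} {y x : Site d} (hx : x ∈ block N y) : (treeWord y x).length ≤ d * (N - 1) := by
  refine length_combFrom_le (fun i => ?_) d
  have h := mem_block.1 hx i
  have hN : 1 ≤ N := by by_contra h0; omega
  rw [Int.toNat_le]; push_cast [hN]; omega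

/-- Translation covariance of the segments of (1.7). [cite: Balaban1984PropagatorsI, (1.7) p. 18] -/
theorem combFrom_shift (y x v : Site d) : ∀ k, combFrom (y + v) (x + v) k = (combFrom y x k).map (shift v)
  | 0 => by simp [combFrom]
  | k + 1 => by
    rw [combFrom, combFrom, List.map_append, ← combFrom_shift y x v k]
    by_cases hk : k < d
    · rw [dif_pos hk, dif_pos hk, seg_map_shift, mixN_add]
      simp
    · rw [dif_neg hk, dif_neg hk, List.map_nil]

/-- Translation covariance of (1.7): `Γ_{y+v, x+v} = Γ_{y,x} + v` (so `Γ_{c₊,x(c)}` is the translate of `Γ_{c₋,x}` by the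
coarse bond). [cite: Balaban1984PropagatorsI, (1.7)–(1.8) pp. 18–19] -/
theorem treeWord_shift (y x v : Site d) : treeWord (y + v) (x + v) = (treeWord y x).map (shift v) :=
  combFrom_shift y x v d

/-- The bonds of the last `k` segments of (1.7): `⟨w, w + e_i⟩` with `w = (y₁, …, y_i + t, x_{i+1}, …, x_d)`, `0 ≤ t < x_i − y_i`. [cite: Balaban1984PropagatorsI, (1.7) p. 18] -/
theorem mem_combFrom_iff {y x : Site d} {l : Letter d} : ∀ {k : ℕ}, l ∈ combFrom y x k ↔
    ∃ i : Fin d, i.val < k ∧ ∃ t < (x i - y i).toNat, l = ((mixN y x (i.val + 1) + (t : ℤ) • ev i, i), true)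
  | 0 => by simp [combFrom]
  | k + 1 => by
    rw [combFrom, List.mem_append, mem_combFrom_iff]
    constructor
    · rintro (h | ⟨i, hlt, t, ht, rfl⟩)
      · by_cases hk : k < d
        · rw [dif_pos hk, mem_seg] at h
          obtain ⟨t, ht, rfl⟩ := h
          exact ⟨⟨k, hk⟩, Nat.lt_succ_self k, t, ht, rfl⟩
        · rw [dif_neg hk] at h; simp at h
      · exact ⟨i, Nat.lt_succ_of_lt hlt, t, ht, rfl⟩
    · rintro ⟨i, hlt, t, ht, rfl⟩
      rcases Nat.lt_succ_iff_lt_or_eq.1 hlt with hlt' | hk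
      · exact Or.inr ⟨i, hlt', t, ht, rfl⟩
      · left
        have hk' : k < d := hk ▸ i.isLt
        have hi : i = ⟨k, hk'⟩ := Fin.ext hk
        subst hi
        rw [dif_pos hk', mem_seg]; exact ⟨t, ht, rfl⟩

/-- All bonds of `Γ_{y,x}` are traversed forward. [cite: Balaban1984PropagatorsI, (1.7) p. 18] -/
theorem snd_of_mem_treeWord {y x : Site d} {l : Letter d} (hl : l ∈ treeWord y x) : l.2 = true := by
  obtain ⟨i, -, t, -, rfl⟩ := mem_combFrom_iff.1 hl; rfl

/-- Coordinates of the points on the segment of (1.7) in direction `i`. [cite: Balaban1984PropagatorsI, (1.7) p. 18] -/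
theorem mixN_add_smul_apply (y x : Site d) (i : Fin d) (t : ℤ) (j : Fin d) :
    (mixN y x (i.val + 1) + t • ev i) j = if j = i then y j + t else mixN y x (i.val + 1) j := by
  by_cases hj : j = i
  · subst hj; simp [mixN]
  · simp [hj, ev_apply_of_ne hj]

/-- The intermediate points of (1.7) lie in `B(y)` when `x ∈ B(y)`. [cite: Balaban1984PropagatorsI, (1.7) p. 18] -/
theorem mixN_apply_mem {N : ℕ} {y x : Site d} (hx : x ∈ block N y) (k : ℕ) (j : Fin d) :
    y j ≤ mixN y x k j ∧ mixN y x k j < y j + N := by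
  have := mem_block.1 hx j
  unfold mixN; split_ifs <;> constructor <;> omega

/-- The endpoints of every bond of `Γ_{y,x}`, `x ∈ B(y)`, lie in the block `B(y)`. [cite: Balaban1984PropagatorsI, (1.6)–(1.7) p. 18] -/
theorem mem_block_of_mem_treeWord {N : ℕ} {y x : Site d} (hx : x ∈ block N y) {l : Letter d} (hl : l ∈ treeWord y x) :
    l.1.1 ∈ block N y ∧ l.1.1 + ev l.1.2 ∈ block N y := by
  have hxb := mem_block.1 hx
  obtain ⟨i, -, t, ht, rfl⟩ := mem_combFrom_iff.1 hl
  have hnn : 0 ≤ x i - y i := by have := hxb i; omega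
  have ht' : (t : ℤ) < x i - y i := by have := Int.toNat_of_nonneg hnn; omega
  have hxi := hxb i
  dsimp only
  constructor
  · refine mem_block.2 fun j => ?_
    rw [mixN_add_smul_apply]
    by_cases hj : j = i
    · subst hj; rw [if_pos rfl]; constructor <;> omega
    · rw [if_neg hj]; exact mixN_apply_mem hx _ j
  · refine mem_block.2 fun j => ?_
    have e : mixN y x (i.val + 1) + (t : ℤ) • ev i + ev i = mixN y x (i.val + 1) + ((t : ℤ) + 1) • ev i := by
      rw [add_smul, one_smul, add_assoc]
    rw [e, mixN_add_smul_apply]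
    by_cases hj : j = i
    · subst hj; rw [if_pos rfl]; constructor <;> omega
    · rw [if_neg hj]; exact mixN_apply_mem hx _ j

/-- **Fidelity certificate.** The bonds of the word `treeWord y x` are EXACTLY the bonds of the tree's (1.7)-contour of
record `B6BondElimination.contour N y x` (for `x ∈ B(y)`). [cite: Balaban1984PropagatorsI, (1.7) p. 18] -/
theorem mem_treeWord_iff {N : ℕ} {y x : Site d} (hx : x ∈ block N y) {l : Letter d} :
    l ∈ treeWord y x ↔ l.2 = true ∧ l.1 ∈ contour N y x := by
  have hxb := mem_block.1 hx
  constructor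
  · intro hl
    have hb := (mem_block_of_mem_treeWord hx hl).1
    obtain ⟨i, -, t, ht, rfl⟩ := mem_combFrom_iff.1 hl
    have hnn : 0 ≤ x i - y i := by have := hxb i; omega
    have ht' : (t : ℤ) < x i - y i := by have := Int.toNat_of_nonneg hnn; omega
    refine ⟨rfl, mem_contour.2 ⟨hb, fun j hj => ?_, fun j hj => ?_, ?_⟩⟩
    · have hj' : j ≠ i := fun h => by subst h; exact lt_irrefl _ hj
      have hjv : ¬ i.val + 1 ≤ j.val := by have : j.val < i.val := hj; omega
      simp only [mixN_add_smul_apply, hj', if_false, mixN, hjv]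
    · have hj' : j ≠ i := fun h => by subst h; exact lt_irrefl _ hj
      have hjv : i.val + 1 ≤ j.val := by have : i.val < j.val := hj; omega
      simp only [mixN_add_smul_apply, hj', if_false, mixN, hjv, if_true]
    · show (mixN y x (i.val + 1) + (t : ℤ) • ev i) i < x i
      rw [mixN_add_smul_apply, if_pos rfl]; omega
  · rintro ⟨h2, hb⟩
    obtain ⟨hw, hlo, hhi, hlt⟩ := mem_contour.1 hb
    rcases l with ⟨⟨w, ν⟩, s⟩
    simp only at h2 hw hlo hhi hlt; subst h2
    have hwb := mem_block.1 hw
    have hwν := hwb ν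
    have hxν := hxb ν
    refine mem_combFrom_iff.2 ⟨ν, ν.isLt, (w ν - y ν).toNat, ?_, ?_⟩
    · have e1 : ((w ν - y ν).toNat : ℤ) = w ν - y ν := Int.toNat_of_nonneg (by omega)
      have e2 : ((x ν - y ν).toNat : ℤ) = x ν - y ν := Int.toNat_of_nonneg (by omega)
      omega
    · congr 2
      funext j
      rw [mixN_add_smul_apply]
      by_cases hj : j = ν
      · subst hj; rw [if_pos rfl, Int.toNat_of_nonneg (by omega)]; ring
      · have hjv : j.val ≠ ν.val := fun h => hj (Fin.ext h)
        rw [if_neg hj]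
        unfold mixN
        rcases Nat.lt_or_gt_of_ne hjv with hlt' | hgt'
        · rw [if_neg (by omega)]; exact hlo j hlt'
        · rw [if_pos (by omega)]; exact hhi j hgt'

/-- `Γ_{y,y}` is the empty word. [cite: Balaban1984PropagatorsI, (1.7) p. 18] -/
theorem treeWord_self (y : Site d) : treeWord y y = [] := by
  suffices h : ∀ k, combFrom y y k = [] from h d
  intro k
  induction k with
  | zero => rfl
  | succ k ih => rw [combFrom, ih]; split_ifs <;> simp

/-! ## §2  The contour of (1.8) for the coarse bond `c = ⟨c₋, c₊⟩`, `c₊ = c₋ + N e_μ`, and `x ∈ B(c₋)` -/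

/-- **The contour of (1.8)** whose group element enters the average for the bond `⟨c₋, c₋ + N e_μ⟩`:
`Γ_{c₋,x} ∪ [x, x(c)] ∪ Γ_{x(c),c₊}` with «x(c) = x + Le_μ» and `Γ_{x(c),c₊}` = the (1.7)-contour `Γ_{c₊,x(c)}` traversed from
`x(c)` to `c₊` («N⁴ contours as enter (in the Abelian case) in (1.8) of [1]», Federbush p. 301).
[cite: Balaban1984PropagatorsI, (1.8) p. 19] -/
def contourWord (N : ℕ) (c : Site d) (μ : Fin d) (x : Site d) : List (Letter d) :=
  treeWord c x ++ seg x μ N ++ rev (treeWord (c + (N : ℤ) • ev μ) (x + (N : ℤ) • ev μ))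

/-- The contour of (1.8) runs from `c₋` to `c₊`. [cite: Balaban1984PropagatorsI, (1.8) p. 19] -/
theorem isPath_contourWord (N : ℕ) {c x : Site d} (μ : Fin d) (hcx : ∀ i, c i ≤ x i) :
    IsPath c (c + (N : ℤ) • ev μ) (contourWord N c μ x) :=
  ((isPath_treeWord hcx).append (isPath_seg x μ N)).append
    (isPath_treeWord (y := c + (N : ℤ) • ev μ) (x := x + (N : ℤ) • ev μ) fun i => by simpa using hcx i).rev

/-- For `x = c₋` the contour is «the straight line contour ⟨c₋, c₊⟩». [cite: Federbush1987PhaseCellIII, §5.2 p. 301] -/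
theorem contourWord_base (N : ℕ) (c : Site d) (μ : Fin d) : contourWord N c μ c = seg c μ N := by
  simp [contourWord, treeWord_self]

/-! ## §3  The ladder: removing one tree bond costs `≤ N` elementary homotopies -/

section Ladder

variable (R : Site d → Fin d → Fin d → Prop) (μ : Fin d) (N : ℕ)

/-- The intermediate contours of the ladder between heights `w + e_ν` and `w`: across at height `w` for `t` steps, up,
across at height `w + e_ν` for the remaining `N − t` steps, down. [cite: Federbush1987PhaseCellIII, §5.2 p. 301] -/
def rungWord (w : Site d) (ν : Fin d) (t : ℕ) : List (Letter d) :=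
  seg w μ t ++ [((w + (t : ℤ) • ev μ, ν), true)] ++ seg (w + ev ν + (t : ℤ) • ev μ) μ (N - t) ++
    [((w + (N : ℤ) • ev μ, ν), false)]

/-- The bottom of the ladder: up `⟨w, w + e_ν⟩`, across at height `w + e_ν`, down. [cite: Federbush1987PhaseCellIII, §5.2 p. 301] -/
theorem rungWord_zero (w : Site d) (ν : Fin d) :
    rungWord μ N w ν 0 = [((w, ν), true)] ++ seg (w + ev ν) μ N ++ [((w + (N : ℤ) • ev μ, ν), false)] := by
  simp [rungWord]

/-- The top of the ladder: across at height `w`, then the backtrack `⟨w + Ne_μ, w + Ne_μ + e_ν⟩` up and down. [cite: Federbush1987PhaseCellIII, §5.2 p. 301] -/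
theorem rungWord_last (w : Site d) (ν : Fin d) :
    rungWord μ N w ν N = seg w μ N ++ [((w + (N : ℤ) • ev μ, ν), true), opp ((w + (N : ℤ) • ev μ, ν), true)] := by
  simp [rungWord, opp]

/-- One rung = one elementary homotopy across the plaquette `(w + t e_μ; μ, ν)` (two sides replaced by the other two).
[cite: Federbush1987PhaseCellIII, §5.1 Fig. 8 p. 301] -/
theorem rungWord_step (w : Site d) (ν : Fin d) {t : ℕ} (ht : t < N) :
    ElemHomotopy (w + (t : ℤ) • ev μ) μ ν (rungWord μ N w ν t) (rungWord μ N w ν (t + 1)) := by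
  obtain ⟨m, hm⟩ : ∃ m, N - t = m + 1 := ⟨N - t - 1, by omega⟩
  have hm' : N - (t + 1) = m := by omega
  have e1 : w + ev ν + (t : ℤ) • ev μ = w + (t : ℤ) • ev μ + ev ν := add_right_comm _ _ _
  have e2 : w + ((t + 1 : ℕ) : ℤ) • ev μ = w + (t : ℤ) • ev μ + ev μ := by
    push_cast; rw [add_smul, one_smul, add_assoc]
  have e3 : w + ev ν + ((t + 1 : ℕ) : ℤ) • ev μ = w + (t : ℤ) • ev μ + ev ν + ev μ := by
    push_cast; rw [add_smul, one_smul, ← add_assoc, e1]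
  refine ⟨seg w μ t, [((w + (t : ℤ) • ev μ, ν), true), ((w + (t : ℤ) • ev μ + ev ν, μ), true)],
    [((w + (t : ℤ) • ev μ, μ), true), ((w + (t : ℤ) • ev μ + ev μ, ν), true)],
    seg (w + (t : ℤ) • ev μ + ev ν + ev μ) μ m ++ [((w + (N : ℤ) • ev μ, ν), false)], ?_, ?_, ?_⟩
  · rw [rungWord, hm, seg_succ', e1]; simp
  · rw [rungWord, hm', seg_succ, e2, e3]; simp
  · have : [((w + (t : ℤ) • ev μ, μ), true), ((w + (t : ℤ) • ev μ + ev μ, ν), true)] ++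
        rev [((w + (t : ℤ) • ev μ, ν), true), ((w + (t : ℤ) • ev μ + ev ν, μ), true)] =
        plaqLoop (w + (t : ℤ) • ev μ) μ ν := by
      simp [plaqLoop, opp]
    rw [this]

/-- Climbing the ladder: `t` rungs = `t` elementary homotopies. [cite: Federbush1987PhaseCellIII, §5.2 p. 301] -/
theorem moves_rungWord (w : Site d) (ν : Fin d) (hR : ∀ s < N, R (w + (s : ℤ) • ev μ) μ ν) :
    ∀ t ≤ N, Moves R t (rungWord μ N w ν 0) (rungWord μ N w ν t)
  | 0, _ => Moves.refl _
  | t + 1, ht => (moves_rungWord w ν hR t (Nat.le_of_succ_le ht)).homotopy (hR t ht) (rungWord_step μ N w ν ht)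

/-- **«the contours associated to x and x′ are related by ≤ N elementary homotopies»**: the contour through the extra tree
bond `⟨w, w + e_ν⟩` (up, across at height `w + e_ν`, down along the translated bond) is related to the straight contour at
height `w` by `N` homotopies across the plaquettes `(w + te_μ; μ, ν)`, `0 ≤ t < N`, and one free cancellation — or, if
`ν = μ`, by a single free cancellation. [cite: Federbush1987PhaseCellIII, §5.2 p. 301] -/
theorem rung (w : Site d) (ν : Fin d) (hR : ν ≠ μ → ∀ s < N, R (w + (s : ℤ) • ev μ) μ ν) :
    ∃ n ≤ N, Moves R n ([((w, ν), true)] ++ seg (w + ev ν) μ N ++ [((w + (N : ℤ) • ev μ, ν), false)])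
      (seg w μ N) := by
  by_cases hνμ : ν = μ
  · subst hνμ
    refine ⟨0, Nat.zero_le _, Moves.backtrack ?_⟩
    have h1 : [((w, ν), true)] ++ seg (w + ev ν) ν N ++ [((w + (N : ℤ) • ev ν, ν), false)] =
        seg w ν N ++ [((w + (N : ℤ) • ev ν, ν), true), opp ((w + (N : ℤ) • ev ν, ν), true)] := by
      rw [List.singleton_append, ← seg_succ', seg_succ]; simp [opp]
    rw [h1]
    exact Backtrack.tail _ _
  · refine ⟨N, le_rfl, ?_⟩
    rw [← rungWord_zero]
    have h := (moves_rungWord R μ N w ν (hR hνμ) N le_rfl).cancel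
      (show Backtrack (rungWord μ N w ν N) (seg w μ N) by rw [rungWord_last]; exact Backtrack.tail _ _)
    exact h

/-- The contour through a tree path `T` ending at `x`: `T`, then `[x, x + N e_μ]`, then the translate of `T` backwards.
[cite: Federbush1987PhaseCellIII, §5.2 p. 301] -/
def ladder (T : List (Letter d)) (x : Site d) : List (Letter d) :=
  T ++ seg x μ N ++ rev (T.map (shift ((N : ℤ) • ev μ)))

/-- No tree bonds: the straight contour. [cite: Federbush1987PhaseCellIII, §5.2 p. 301] -/
theorem ladder_nil (x : Site d) : ladder μ N [] x = seg x μ N := by simp [ladder]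

/-- Peeling the first tree bond off the contour. [cite: Federbush1987PhaseCellIII, §5.2 p. 301] -/
theorem ladder_cons (l : Letter d) (T : List (Letter d)) (x : Site d) :
    ladder μ N (l :: T) x = [l] ++ ladder μ N T x ++ [opp (shift ((N : ℤ) • ev μ) l)] := by
  simp [ladder]

/-- **«Thus any contour is related to the straight line contour … by ≤ 4(N − 1)N elementary homotopies»**, engine: for every
FORWARD tree path `T` from `y` to `x`, the contour `T ∪ [x, x + Ne_μ] ∪ (T + Ne_μ)⁻¹` is related to `[y, y + Ne_μ]` by
`≤ N·|T|` elementary homotopies across the plaquettes `(w + te_μ; μ, ν)` swept by the bonds `⟨w, w + e_ν⟩` of `T` not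
parallel to `e_μ` (induction on `T`, one `rung` per bond). [cite: Federbush1987PhaseCellIII, §5.2 p. 301] -/
theorem moves_ladder : ∀ (T : List (Letter d)) (y x : Site d), IsPath y x T → (∀ l ∈ T, l.2 = true) →
    (∀ l ∈ T, l.1.2 ≠ μ → ∀ s < N, R (l.1.1 + (s : ℤ) • ev μ) μ l.1.2) →
    ∃ n ≤ N * T.length, Moves R n (ladder μ N T x) (seg y μ N)
  | [], y, x, hp, _, _ => by
    simp only [isPath_nil] at hp; subst hp
    exact ⟨0, Nat.zero_le _, by rw [ladder_nil]; exact Moves.refl _⟩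
  | l :: T, y, x, hp, hfwd, hR => by
    rcases l with ⟨⟨w, ν⟩, s⟩
    have hs : s = true := hfwd _ (List.mem_cons_self)
    subst hs
    obtain ⟨hsrc, hp'⟩ := hp
    simp only [src_true] at hsrc; subst hsrc
    obtain ⟨n₁, hn₁, h₁⟩ := moves_ladder T (w + ev ν) x hp' (fun l hl => hfwd l (List.mem_cons_of_mem _ hl))
      (fun l hl => hR l (List.mem_cons_of_mem _ hl))
    obtain ⟨n₂, hn₂, h₂⟩ := rung R μ N w ν (fun hne => hR _ (List.mem_cons_self) hne)
    refine ⟨n₁ + n₂, ?_, ?_⟩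
    · rw [List.length_cons, Nat.mul_succ]; omega
    · rw [ladder_cons]
      exact (h₁.frame [((w, ν), true)] [opp (shift ((N : ℤ) • ev μ) ((w, ν), true))]).trans h₂

end Ladder

/-! ## §4  The count: `≤ d(N−1)N` to the straight contour, `≤ 2d(N−1)N` between any two (`8(N−1)N` for `d = 4`) -/

/-- The sites of the two blocks `B(c₋) ∪ B(c₊)` of the bond (two of «the four N⁴ size blocks, vertices of the plaquette P»).
[cite: Federbush1987PhaseCellIII, §4 p. 298; §5.3 1) p. 303] -/
noncomputable def twoBlocks (N : ℕ) (c : Site d) (μ : Fin d) : Finset (Site d) := block N c ∪ block N (c + (N : ℤ) • ev μ)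

/-- The admissible plaquettes `(z; μ′, ν′)`: genuine (`μ′ ≠ ν′`) with all four vertices in `B(c₋) ∪ B(c₊)` («those
plaquettes … all of whose vertices lie in the four N⁴ size blocks», restricted to the two blocks of the bond).
[cite: Federbush1987PhaseCellIII, §4 p. 298] -/
def Admissible (N : ℕ) (c : Site d) (μ : Fin d) (z : Site d) (μ' ν' : Fin d) : Prop :=
  μ' ≠ ν' ∧ z ∈ twoBlocks N c μ ∧ z + ev μ' ∈ twoBlocks N c μ ∧ z + ev ν' ∈ twoBlocks N c μ ∧
    z + ev μ' + ev ν' ∈ twoBlocks N c μ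

/-- Admissibility does not depend on the orientation of the plaquette. [cite: Federbush1987PhaseCellIII, §4 p. 298] -/
theorem Admissible.symm {N : ℕ} {c : Site d} {μ : Fin d} {z : Site d} {μ' ν' : Fin d}
    (h : Admissible N c μ z μ' ν') : Admissible N c μ z ν' μ' := by
  obtain ⟨hne, h0, h1, h2, h3⟩ := h
  exact ⟨hne.symm, h0, h2, h1, by rwa [add_right_comm]⟩

/-- «x(c) = x + Le_μ»: translating a site of `B(c₋)` by `s ≤ N` steps along `e_μ` stays in `B(c₋) ∪ B(c₊)`. [cite: Federbush1987PhaseCellIII, §4 p. 298] -/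
theorem mem_twoBlocks_of_mem_block {N : ℕ} {c v : Site d} (μ : Fin d) (hv : v ∈ block N c) {s : ℕ} (hs : s ≤ N) :
    v + (s : ℤ) • ev μ ∈ twoBlocks N c μ := by
  have hvb := mem_block.1 hv
  rw [twoBlocks, Finset.mem_union, mem_block, mem_block]
  by_cases hlt : v μ + s < c μ + N
  · left; intro i
    simp only [Pi.add_apply, Pi.smul_apply, smul_eq_mul, ev_apply]
    by_cases hi : i = μ
    · subst hi; have := hvb i; simp; constructor <;> omega
    · have := hvb i; simp [hi, this]
  · right; intro i
    simp only [Pi.add_apply, Pi.smul_apply, smul_eq_mul, ev_apply]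
    by_cases hi : i = μ
    · subst hi; have := hvb i; simp; constructor <;> omega
    · have := hvb i; simp [hi, this]

/-- The ladder plaquettes of a tree bond of `B(c₋)` are admissible. [cite: Federbush1987PhaseCellIII, §5.2 p. 301] -/
theorem admissible_of_mem_block {N : ℕ} {c w : Site d} {μ ν : Fin d} (hne : ν ≠ μ) (hw : w ∈ block N c)
    (hw' : w + ev ν ∈ block N c) {s : ℕ} (hs : s < N) : Admissible N c μ (w + (s : ℤ) • ev μ) μ ν := by
  have e1 : w + (s : ℤ) • ev μ + ev μ = w + ((s + 1 : ℕ) : ℤ) • ev μ := by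
    push_cast; rw [add_smul, one_smul, add_assoc]
  have e2 : w + (s : ℤ) • ev μ + ev ν = w + ev ν + (s : ℤ) • ev μ := add_right_comm _ _ _
  have e3 : w + (s : ℤ) • ev μ + ev μ + ev ν = w + ev ν + ((s + 1 : ℕ) : ℤ) • ev μ := by
    rw [add_right_comm _ (ev μ), e2, add_assoc]; push_cast; rw [add_smul, one_smul]
  refine ⟨hne.symm, mem_twoBlocks_of_mem_block μ hw hs.le, ?_, ?_, ?_⟩
  · rw [e1]; exact mem_twoBlocks_of_mem_block μ hw hs
  · rw [e2]; exact mem_twoBlocks_of_mem_block μ hw' hs.le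
  · rw [e3]; exact mem_twoBlocks_of_mem_block μ hw' hs

/-- The contour of (1.8) is the ladder word of its tree part (translation covariance of (1.7)).
[cite: Balaban1984PropagatorsI, (1.7)–(1.8) pp. 18–19] -/
theorem contourWord_eq_ladder (N : ℕ) (c : Site d) (μ : Fin d) (x : Site d) :
    contourWord N c μ x = ladder μ N (treeWord c x) x := by
  rw [contourWord, ladder, treeWord_shift]

/-- **«Thus any contour is related to the straight line contour ⟨c₋, c₊⟩ by ≤ 4(N − 1)N elementary homotopies»** — here
`≤ N·|Γ_{c₋,x}| ≤ d(N−1)·N`, across admissible plaquettes only. [cite: Federbush1987PhaseCellIII, §5.2 p. 301] -/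
theorem moves_contourWord_straight {N : ℕ} {c x : Site d} (μ : Fin d) (hx : x ∈ block N c) :
    ∃ n ≤ d * (N - 1) * N, Moves (Admissible N c μ) n (contourWord N c μ x) (seg c μ N) := by
  have hcx : ∀ i, c i ≤ x i := fun i => (mem_block.1 hx i).1
  obtain ⟨n, hn, h⟩ := moves_ladder (Admissible N c μ) μ N (treeWord c x) c x (isPath_treeWord hcx)
    (fun l hl => snd_of_mem_treeWord hl)
    (fun l hl hne s hs => by
      obtain ⟨hw, hw'⟩ := mem_block_of_mem_treeWord hx hl
      exact admissible_of_mem_block hne hw hw' hs)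
  refine ⟨n, hn.trans ?_, by rwa [contourWord_eq_ladder]⟩
  calc N * (treeWord c x).length ≤ N * (d * (N - 1)) := Nat.mul_le_mul_left _ (length_treeWord_le hx)
    _ = d * (N - 1) * N := by ring

/-- **«and any two contours are related by ≤ 8(N − 1)N elementary homotopies»** — `≤ 2d(N−1)N` in dimension `d`, across
plaquettes all of whose vertices lie in `B(c₋) ∪ B(c₊)`. [cite: Federbush1987PhaseCellIII, §5.2 p. 301] -/
theorem moves_contourWord_contourWord {N : ℕ} {c x x' : Site d} (μ : Fin d) (hx : x ∈ block N c)
    (hx' : x' ∈ block N c) :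
    ∃ n ≤ 2 * d * (N - 1) * N, Moves (Admissible N c μ) n (contourWord N c μ x) (contourWord N c μ x') := by
  obtain ⟨n₁, hn₁, h₁⟩ := moves_contourWord_straight μ hx
  obtain ⟨n₂, hn₂, h₂⟩ := moves_contourWord_straight μ hx'
  refine ⟨n₁ + n₂, ?_, h₁.trans (h₂.symm fun z μ' ν' h => h.symm)⟩
  calc n₁ + n₂ ≤ d * (N - 1) * N + d * (N - 1) * N := add_le_add hn₁ hn₂
    _ = 2 * d * (N - 1) * N := by ring

/-- The printed numbers (d = 4): `≤ 4(N−1)N` to the straight contour and `≤ 8(N−1)N` between any two.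
[cite: Federbush1987PhaseCellIII, §5.2 p. 301] -/
theorem moves_contourWord_contourWord_dim4 {N : ℕ} {c x x' : Site 4} (μ : Fin 4) (hx : x ∈ block N c)
    (hx' : x' ∈ block N c) :
    (∃ n ≤ 4 * (N - 1) * N, Moves (Admissible N c μ) n (contourWord N c μ x) (seg c μ N)) ∧
    (∃ n ≤ 8 * (N - 1) * N, Moves (Admissible N c μ) n (contourWord N c μ x) (contourWord N c μ x')) :=
  ⟨moves_contourWord_straight μ hx, by simpa [show 2 * 4 = 8 by norm_num] using moves_contourWord_contourWord μ hx hx'⟩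

/-! ## §5  Lemma 5.6 (5.13): `d(g_{Γ₁}, g_{Γ₂}) ≤ 8(N−1)N·a` -/

section Metric

variable {G : Type*} [Group G] [MetricSpace G] [IsIsometricSMul G G] [IsIsometricSMul Gᵐᵒᵖ G]

/-- **Lemma 5.6 (5.13), the count discharged.** «Let Γ₁ and Γ₂ be two contours whose associated group elements are
averaged (along with N⁴ − 2 others) to yield a group assignment to a bond of P. Assume all p_i are s.f. Then
d(g_{Γ₁}, g_{Γ₂}) ≤ 8(N − 1)Na.» — for Bałaban's contours (1.8) of the bond `⟨c₋, c₋ + Ne_μ⟩`, `x, x′ ∈ B(c₋)`, in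
dimension `d`: if every genuine plaquette with all four vertices in `B(c₋) ∪ B(c₊)` is s.f. (`|g_{∂p}| < a`), then
`d(g_{Γ(x)}, g_{Γ(x′)}) ≤ 2d(N−1)N·a` — THROUGH r17's `PureAverages.dist_le_of_chain_count`, whose hypotheses `hstep`
(lattice bookkeeping), `hsf` and `hn` (the count) are supplied by `moves_contourWord_contourWord`.
[cite: Federbush1987PhaseCellIII, Lemma 5.6 (5.13) p. 301] -/
theorem lemma56 {N : ℕ} {c x x' : Site d} (μ : Fin d) (hx : x ∈ block N c) (hx' : x' ∈ block N c)
    (u : Bond d → G) {a : ℝ} (ha : 0 ≤ a)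
    (hsf : ∀ z μ' ν', Admissible N c μ z μ' ν' → absG (wordHol u (plaqLoop z μ' ν')) < a) :
    dist (wordHol u (contourWord N c μ x)) (wordHol u (contourWord N c μ x')) ≤ (2 * d * (N - 1) * N : ℕ) * a := by
  obtain ⟨n, hn, h⟩ := moves_contourWord_contourWord μ hx hx'
  exact h.dist_wordHol_le_of_le u hn ha hsf

/-- (5.13) with the printed constant, `d = 4`: `d(g_{Γ₁}, g_{Γ₂}) ≤ 8(N − 1)N·a`.
[cite: Federbush1987PhaseCellIII, Lemma 5.6 (5.13) p. 301] -/
theorem lemma56_dim4 {N : ℕ} {c x x' : Site 4} (μ : Fin 4) (hx : x ∈ block N c) (hx' : x' ∈ block N c)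
    (u : Bond 4 → G) {a : ℝ} (ha : 0 ≤ a)
    (hsf : ∀ z μ' ν', Admissible N c μ z μ' ν' → absG (wordHol u (plaqLoop z μ' ν')) < a) :
    dist (wordHol u (contourWord N c μ x)) (wordHol u (contourWord N c μ x')) ≤ (8 * (N - 1) * N : ℕ) * a := by
  have h := lemma56 μ hx hx' u ha hsf
  simpa [show 2 * 4 = 8 by norm_num] using h

/-- The distance of every contour of (1.8) to the straight contour: `≤ d(N−1)N·a` (`4(N−1)Na` for `d = 4`).
[cite: Federbush1987PhaseCellIII, §5.2 p. 301] -/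
theorem dist_contourWord_straight_le {N : ℕ} {c x : Site d} (μ : Fin d) (hx : x ∈ block N c)
    (u : Bond d → G) {a : ℝ} (ha : 0 ≤ a)
    (hsf : ∀ z μ' ν', Admissible N c μ z μ' ν' → absG (wordHol u (plaqLoop z μ' ν')) < a) :
    dist (wordHol u (contourWord N c μ x)) (wordHol u (seg c μ N)) ≤ (d * (N - 1) * N : ℕ) * a := by
  obtain ⟨n, hn, h⟩ := moves_contourWord_straight μ hx
  exact h.dist_wordHol_le_of_le u hn ha hsf

end Metric

end LatticeContour

end Literature.MathematicalPhysics.QuantumFieldTheory.Federbush1986
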